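import Literature.Analysis.FluidPDE.CompressibleEulerC1Continuation
import Literature.Analysis.FluidPDE.CompressibleEulerSymmetricForm
import Literature.Analysis.PDE.TorusQuasilinearLocalExistence
import Literature.MathematicalPhysics.KineticTheory.HardSphereEulerSymmetricForm
import HarnessLib

/-!
# Local classical solutions of the complete Euler system of a monatomic fluid on `𝕋³`: the
# discharge of `CompressibleEulerLocalWellPosedness` (topic `Analysis/FluidPDE`)

Analysis/FluidPDE proof file (theorems only; no definitions, no named facts) discharging the
named fact `Literature.Analysis.FluidPDE.CompressibleEulerLocalWellPosedness`
(`CompressibleEulerWellPosedness.lean`: Majda 1984, Ch. 2, Thms 2.1–2.2 with Cor. 1–2, for the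
`5 × 5` Euler system of a monatomic fluid with the athermal pressure law `p = ρϑζ(ρ)`,
`e = 3ϑ/2`, `ζ` smooth, `(ρζ)' > 0` on `(0, ρ̄)`, smooth periodic data `0 < ρ₀ < ρ̄`, `ϑ₀ > 0`).

* `CompressibleEuler.localExistence_monatomicExcess` — clause (i), LOCAL EXISTENCE (Majda, Thm 2.1;
  Dafermos 2005, Thm 5.1.1, existence part): in the variables `V = (ρ, u₁, u₂, u₃, ϑ) ∈ ℝ⁵` the
  system is the quasilinear symmetric hyperbolic system `A⁰(V)∂ₜV + ∑ₖ Aₖ(V)∂ₖV = 0` with the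
  DIAGONAL Friedrichs symmetriser `A⁰ = diag(ϑh'(ρ)/ρ, ρ, ρ, ρ, 3ρ/(2ϑ))`, `h(ρ) = ρζ(ρ)`, and
  `Aₖ = uₖA⁰ + ϑh'(ρ)(E_{0,k+1} + E_{k+1,0}) + h(ρ)(E_{k+1,4} + E_{4,k+1})` (Majda 1984, §1.2; the
  constant matrices `hsSymD0/D1/D4`, `hsSymP/Q` of `HardSphereEulerSymmetricForm`), positive
  definite on the state domain `𝒪 = {0 < ρ < ρ̄, ϑ > 0}` exactly by the hypothesis `h' > 0`; the
  general local existence theorem for such systems on `𝕋³`, PROVED in the tree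
  (`Literature.Analysis.PDE.symmHyperbolicLocalExistence_of_diagonal`, `TorusQuasilinearLocalExistence`),
  gives a jointly smooth `V` on `[0, T) × 𝕋³` with values in `𝒪`; its rows are the continuity,
  expanded Euler and temperature equations of the symmetrisable form, so `V` is a classical
  solution (`IsPrimitiveEulerSolutionOn.of_symmetric_monatomicExcess`,
  `isClassicalEulerSolution_monatomicExcess_of_primitive`), with density `< ρ̄` because `V ∈ 𝒪`.
* `CompressibleEulerLocalWellPosedness_holds` — the whole fact: clause (ii) (continuation, Majda
  Thm 2.2 with Cor. 1–2) is already a theorem of the tree given clause (i)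
  (`compressibleEulerLocalWellPosedness_of_localExistence`, `CompressibleEulerC1Continuation`).

This is the assembly announced in `HardSphereEulerSymmetricForm.lean` ("clause (i) of
`CompressibleEulerLocalWellPosedness` by the same assembly for a general `ζ`"), written with the
scalars of the symmetric form abstracted (`symForm_row_zero/_vel/_four`, `isSymm_symForm`,
`symFormA0_eq_diagonal`) so that no new definition is needed.

## Mathlib / tree search

Tree: `symmHyperbolicLocalExistence_of_diagonal` (`Analysis/PDE/TorusQuasilinearLocalExistence`);
`hsSymD0`, `hsSymD1`, `hsSymD4`, `hsSymP`, `hsSymQ`, `hsVelIdx`, `hsVelPart`, `hsStateVec`,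
`isSmooth_hsStateVec`, `timeDerivWithin_clm_apply`, `partialDeriv_clm_apply_of_isContDiff`,
`hsState_contDiffOn_coord` (`KineticTheory/HardSphereEulerSymmetricForm`);
`IsPrimitiveEulerSolutionOn.of_symmetric_monatomicExcess`, `contDiff_deriv_mul_zeta`
(`CompressibleEulerSymmetricForm`); `isClassicalEulerSolution_monatomicExcess_of_primitive`
(`CompressibleEulerPrimitiveForm`); `compressibleEulerLocalWellPosedness_of_localExistence`
(`CompressibleEulerC1Continuation`); `Torus.gradient_eq_sum_partialDeriv`,
`Torus.partialDeriv_apply_coord`. Mathlib: `Matrix.posDef_diagonal_iff`, `Matrix.IsSymm.ext`.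

## References

* A. Majda, *Compressible Fluid Flow and Systems of Conservation Laws in Several Space
  Variables*, Appl. Math. Sci. 53, Springer 1984, §1.2 and Ch. 2 §2.1, Thms 2.1–2.2, Cor. 1–2.
  [`Majda1984`]
* C. M. Dafermos, *Hyperbolic Conservation Laws in Continuum Physics*, 2nd ed., Springer 2005,
  §5.1, Thm 5.1.1. [`Dafermos2005`]
* T. Kato, Arch. Rational Mech. Anal. 58 (1975) 181–205, Thms I–II. [`Kato1975`]
-/

noncomputable section

open Set Filter Function
open scoped ContDiff Topology

namespace Literature.Analysis.FluidPDE

open Literature.Analysis.FunctionSpaces Literature.Analysis.FunctionSpaces.Torus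
open Literature.MathematicalPhysics.KineticTheory

namespace CompressibleEuler

/-! ## The symmetric form with abstract scalars: rows, symmetry, diagonal structure -/

/-- Row `0` (density) of `A⁰w₀ + ∑ₖ Aₖwₖ` for `A⁰ = aE₀₀ + b(E₁₁+E₂₂+E₃₃) + cE₄₄`,
`Aₖ = vₖA⁰ + d(E_{0,k+1} + E_{k+1,0}) + e(E_{k+1,4} + E_{4,k+1})`. [folklore] -/
theorem symForm_row_zero (a b c d e : ℝ) (vel : Fin 3 → ℝ) (w₀ : Fin 5 → ℝ)
    (w : Fin 3 → Fin 5 → ℝ) :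
    ((a • hsSymD0 + b • hsSymD1 + c • hsSymD4).mulVec w₀ +
        ∑ k, (vel k • (a • hsSymD0 + b • hsSymD1 + c • hsSymD4) + d • hsSymP k +
          e • hsSymQ k).mulVec (w k)) 0 =
      a * (w₀ 0 + ∑ k, vel k * w k 0) + d * ∑ k, w k (hsVelIdx k) := by
  simp [hsSymD0, hsSymD1, hsSymD4, hsSymP, hsSymQ, dotProduct, Fin.sum_univ_five,
    Fin.sum_univ_three]
  ring

/-- Rows `1, 2, 3` (velocity) of `A⁰w₀ + ∑ₖ Aₖwₖ`. [folklore] -/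
theorem symForm_row_vel (a b c d e : ℝ) (vel : Fin 3 → ℝ) (w₀ : Fin 5 → ℝ)
    (w : Fin 3 → Fin 5 → ℝ) (j : Fin 3) :
    ((a • hsSymD0 + b • hsSymD1 + c • hsSymD4).mulVec w₀ +
        ∑ k, (vel k • (a • hsSymD0 + b • hsSymD1 + c • hsSymD4) + d • hsSymP k +
          e • hsSymQ k).mulVec (w k)) (hsVelIdx j) =
      b * (w₀ (hsVelIdx j) + ∑ k, vel k * w k (hsVelIdx j)) + d * w j 0 + e * w j 4 := by
  fin_cases j <;>
  · simp [hsSymD0, hsSymD1, hsSymD4, hsSymP, hsSymQ, dotProduct, Fin.sum_univ_five,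
      Fin.sum_univ_three]
    ring

/-- Row `4` (temperature) of `A⁰w₀ + ∑ₖ Aₖwₖ`. [folklore] -/
theorem symForm_row_four (a b c d e : ℝ) (vel : Fin 3 → ℝ) (w₀ : Fin 5 → ℝ)
    (w : Fin 3 → Fin 5 → ℝ) :
    ((a • hsSymD0 + b • hsSymD1 + c • hsSymD4).mulVec w₀ +
        ∑ k, (vel k • (a • hsSymD0 + b • hsSymD1 + c • hsSymD4) + d • hsSymP k +
          e • hsSymQ k).mulVec (w k)) 4 =
      c * (w₀ 4 + ∑ k, vel k * w k 4) + e * ∑ k, w k (hsVelIdx k) := by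
  simp [hsSymD0, hsSymD1, hsSymD4, hsSymP, hsSymQ, dotProduct, Fin.sum_univ_five,
    Fin.sum_univ_three]
  ring

/-- The matrices `Aₖ` of the symmetric form are symmetric. [folklore] -/
theorem isSymm_symForm (a b c d e v : ℝ) (k : Fin 3) :
    (v • (a • hsSymD0 + b • hsSymD1 + c • hsSymD4) + d • hsSymP k + e • hsSymQ k).IsSymm := by
  refine Matrix.IsSymm.ext fun i j => ?_
  fin_cases k <;> fin_cases i <;> fin_cases j <;>
    simp [hsSymD0, hsSymD1, hsSymD4, hsSymP, hsSymQ, Matrix.add_apply]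

/-- The symmetriser `A⁰ = aE₀₀ + b(E₁₁+E₂₂+E₃₃) + cE₄₄` is the diagonal matrix
`diag(a, b, b, b, c)`. [folklore] -/
theorem symFormA0_eq_diagonal (a b c : ℝ) :
    a • hsSymD0 + b • hsSymD1 + c • hsSymD4 = Matrix.diagonal ![a, b, b, b, c] := by
  ext i j
  fin_cases i <;> fin_cases j <;> simp [hsSymD0, hsSymD1, hsSymD4, Matrix.diagonal]

/-- `A⁰ = diag(a, b, b, b, c)` is positive definite for `a, b, c > 0`. [folklore] -/
theorem posDef_symFormA0 {a b c : ℝ} (ha : 0 < a) (hb : 0 < b) (hc : 0 < c) :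
    (a • hsSymD0 + b • hsSymD1 + c • hsSymD4).PosDef := by
  rw [symFormA0_eq_diagonal, Matrix.posDef_diagonal_iff]
  intro i
  fin_cases i <;> simp <;> assumption

/-- Coordinates of the torus gradient are the partial derivatives (`C¹` functions). [folklore] -/
theorem torusGradient_apply {θ : T3 → ℝ} (hθ : IsContDiff 1 θ) (x : T3) (j : Fin 3) :
    Torus.gradient θ x j = Torus.partialDeriv j θ x := by
  rw [Torus.gradient_eq_sum_partialDeriv hθ]
  simp [Finset.sum_apply, Pi.single_apply]

/-! ## Clause (i): local existence -/

variable {ζ f : ℝ → ℝ} {ρm : ℝ}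

/-- **Local classical solutions for the athermal monatomic law `p = ρϑζ(ρ)`, `e = 3ϑ/2` on
`𝕋³`** (clause (i) of `CompressibleEulerLocalWellPosedness`; Majda 1984, Ch. 2, Thm 2.1;
Dafermos 2005, Thm 5.1.1): for `ζ` smooth with `(ρζ)' > 0` on `(0, ρ̄)`, smooth data
`0 < ρ₀ < ρ̄`, `ϑ₀ > 0`, `u₀` launch, for some `T > 0`, a classical solution on `[0, T) × 𝕋³`
with these data and density `< ρ̄`. Proof: the symmetric form in `V = (ρ, u, ϑ)` with the
diagonal symmetriser `diag(ϑh'(ρ)/ρ, ρ, ρ, ρ, 3ρ/(2ϑ))` on `𝒪 = {0 < ρ < ρ̄, ϑ > 0}` satisfies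
the hypotheses of `symmHyperbolicLocalExistence_of_diagonal`; the rows of the resulting system
are the three equations of `IsPrimitiveEulerSolutionOn.of_symmetric_monatomicExcess`.
[cite: Majda1984, Ch. 2 §2.1 Thm 2.1] -/
theorem localExistence_monatomicExcess (hζ : ContDiff ℝ ∞ ζ) (_hρm : 0 < ρm)
    (hhyp : ∀ r ∈ Ioo 0 ρm, 0 < deriv (fun s => s * ζ s) r)
    {ρ₀ θ₀ : T3 → ℝ} {u₀ : T3 → V3} (hρ₀ : IsSmooth ρ₀) (hθ₀ : IsSmooth θ₀) (hu₀ : IsSmooth u₀)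
    (hρ₀pos : ∀ x, 0 < ρ₀ x) (hρ₀lt : ∀ x, ρ₀ x < ρm) (hθ₀pos : ∀ x, 0 < θ₀ x) :
    ∃ T : ℝ, 0 < T ∧ ∃ (ρ θ : ℝ → T3 → ℝ) (u : ℝ → T3 → V3),
      IsClassicalEulerSolution (EulerEOS.monatomicExcess ζ f) T ρ u θ ∧
        ρ 0 = ρ₀ ∧ u 0 = u₀ ∧ θ 0 = θ₀ ∧ ∀ t ∈ Ico 0 T, ∀ x, ρ t x < ρm := by
  -- the derivative of `h(s) = s ζ(s)`
  have hh' : ContDiff ℝ ∞ (deriv fun s : ℝ => s * ζ s) := contDiff_deriv_mul_zeta hζ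
  -- the state domain
  set O : Set (EuclideanSpace ℝ (Fin 5)) := {v | 0 < v 0 ∧ v 0 < ρm ∧ 0 < v 4} with hO_def
  have hO : IsOpen O := by
    have h0 : Continuous fun v : EuclideanSpace ℝ (Fin 5) => v 0 := (EuclideanSpace.proj (0 : Fin 5)).continuous
    have h4 : Continuous fun v : EuclideanSpace ℝ (Fin 5) => v 4 := (EuclideanSpace.proj (4 : Fin 5)).continuous
    have h : O = ({v : EuclideanSpace ℝ (Fin 5) | 0 < v 0} ∩ {v : EuclideanSpace ℝ (Fin 5) | v 0 < ρm}) ∩ {v : EuclideanSpace ℝ (Fin 5) | 0 < v 4} := by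
      ext v; simp [hO_def, and_assoc]
    rw [h]
    exact ((isOpen_lt continuous_const h0).inter (isOpen_lt h0 continuous_const)).inter
      (isOpen_lt continuous_const h4)
  -- the scalar coefficient functions and their smoothness on `O`
  have hc0 : ∀ i, ContDiffOn ℝ ∞ (fun v : EuclideanSpace ℝ (Fin 5) => v i) O := fun i => hsState_contDiffOn_coord i O
  have hne0 : ∀ v ∈ O, (fun v : EuclideanSpace ℝ (Fin 5) => v 0) v ≠ 0 := fun v hv => hv.1.ne'
  have hne4 : ∀ v ∈ O, (fun v : EuclideanSpace ℝ (Fin 5) => 2 * v 4) v ≠ 0 := fun v hv => by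
    have := hv.2.2; positivity
  have hd : ContDiffOn ℝ ∞ (fun v : EuclideanSpace ℝ (Fin 5) => v 4 * deriv (fun s : ℝ => s * ζ s) (v 0)) O :=
    (hc0 4).mul (hh'.comp_contDiffOn (hc0 0))
  have ha : ContDiffOn ℝ ∞ (fun v : EuclideanSpace ℝ (Fin 5) => v 4 * deriv (fun s : ℝ => s * ζ s) (v 0) / v 0) O :=
    hd.div (hc0 0) hne0
  have hc : ContDiffOn ℝ ∞ (fun v : EuclideanSpace ℝ (Fin 5) => 3 * v 0 / (2 * v 4)) O :=
    (contDiffOn_const.mul (hc0 0)).div (contDiffOn_const.mul (hc0 4)) hne4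
  have he : ContDiffOn ℝ ∞ (fun v : EuclideanSpace ℝ (Fin 5) => v 0 * ζ (v 0)) O :=
    (hc0 0).mul (hζ.comp_contDiffOn (hc0 0))
  -- the coefficient matrices
  set A₀ : EuclideanSpace ℝ (Fin 5) → Matrix (Fin 5) (Fin 5) ℝ := fun v =>
    (v 4 * deriv (fun s : ℝ => s * ζ s) (v 0) / v 0) • hsSymD0 + v 0 • hsSymD1 +
      (3 * v 0 / (2 * v 4)) • hsSymD4 with hA₀_def
  set A : Fin 3 → EuclideanSpace ℝ (Fin 5) → Matrix (Fin 5) (Fin 5) ℝ := fun k v =>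
    v (hsVelIdx k) • A₀ v + (v 4 * deriv (fun s : ℝ => s * ζ s) (v 0)) • hsSymP k +
      (v 0 * ζ (v 0)) • hsSymQ k with hA_def
  have hA0s : ∀ i j, ContDiffOn ℝ ∞ (fun v => A₀ v i j) O := by
    intro i j
    simp only [hA₀_def, Matrix.add_apply, Matrix.smul_apply, smul_eq_mul]
    exact ((ha.mul contDiffOn_const).add ((hc0 0).mul contDiffOn_const)).add
      (hc.mul contDiffOn_const)
  have hAs : ∀ k i j, ContDiffOn ℝ ∞ (fun v => A k v i j) O := by
    intro k i j
    simp only [hA_def, Matrix.add_apply, Matrix.smul_apply, smul_eq_mul]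
    exact ((((hc0 _).mul (hA0s i j)).add (hd.mul contDiffOn_const)).add
      (he.mul contDiffOn_const))
  have hPD : ∀ v ∈ O, (A₀ v).PosDef := by
    intro v hv
    have h1 : 0 < deriv (fun s : ℝ => s * ζ s) (v 0) := hhyp _ ⟨hv.1, hv.2.1⟩
    have h0 := hv.1
    have h4 := hv.2.2
    exact posDef_symFormA0 (by positivity) h0 (by positivity)
  have hdiag : ∀ v ∈ O, ∀ i j, i ≠ j → A₀ v i j = 0 := by
    intro v _ i j hij
    simp only [hA₀_def]
    rw [symFormA0_eq_diagonal]
    exact Matrix.diagonal_apply_ne _ hij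
  have hSy : ∀ k, ∀ v ∈ O, (A k v).IsSymm := fun k v _ => isSymm_symForm _ _ _ _ _ _ k
  -- the data
  have hV₀ : IsSmooth (hsStateVec ρ₀ u₀ θ₀) := isSmooth_hsStateVec hρ₀ hθ₀ hu₀
  have hK : ∃ K, IsCompact K ∧ K ⊆ O ∧ ∀ x, hsStateVec ρ₀ u₀ θ₀ x ∈ K := by
    refine ⟨range (hsStateVec ρ₀ u₀ θ₀), isCompact_range hV₀.continuous, ?_, fun x => ⟨x, rfl⟩⟩
    rintro _ ⟨x, rfl⟩
    exact ⟨by simpa using hρ₀pos x, by simpa using hρ₀lt x, by simpa using hθ₀pos x⟩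
  -- the local existence theorem for symmetric hyperbolic systems
  obtain ⟨T, hT, V, hV, hV0, hVO, hEq⟩ := Literature.Analysis.PDE.symmHyperbolicLocalExistence_of_diagonal 5 O A₀ A hO
    hA0s hAs hPD hdiag hSy (hsStateVec ρ₀ u₀ θ₀) hV₀ hK
  refine ⟨T, hT, fun t x => V t x 0, fun t x => V t x 4, fun t x => hsVelPart (V t x), ?_, ?_, ?_,
    ?_, fun t ht x => (hVO t ht x).2.1⟩
  rotate_left
  · funext x; simp [hV0]
  · funext x; simp [hV0]
  · funext x; simp [hV0]
  -- the solution of the symmetric system is a classical Euler solution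
  have hS : UniqueDiffOn ℝ (Ico 0 T) := uniqueDiffOn_Ico 0 T
  have hρ : Torus.IsSmoothSpaceTimeOn (Ico 0 T) (fun t x => V t x 0) :=
    hV.clm_comp (EuclideanSpace.proj (0 : Fin 5))
  have hθ : Torus.IsSmoothSpaceTimeOn (Ico 0 T) (fun t x => V t x 4) :=
    hV.clm_comp (EuclideanSpace.proj (4 : Fin 5))
  have hu : Torus.IsSmoothSpaceTimeOn (Ico 0 T) (fun t x => hsVelPart (V t x)) := hV.clm_comp hsVelPart
  have hV1 : ∀ {t}, t ∈ Ico 0 T → IsContDiff 1 (V t) := fun ht =>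
    (hV.isSmooth_slice ht).isContDiff (by simp)
  have hρ1 : ∀ {t}, t ∈ Ico 0 T → IsContDiff 1 (fun y => V t y 0) := fun ht =>
    (hρ.isSmooth_slice ht).isContDiff (by simp)
  have hθ1 : ∀ {t}, t ∈ Ico 0 T → IsContDiff 1 (fun y => V t y 4) := fun ht =>
    (hθ.isSmooth_slice ht).isContDiff (by simp)
  have hu1 : ∀ {t}, t ∈ Ico 0 T → IsContDiff 1 (fun y => hsVelPart (V t y)) := fun ht =>
    (hu.isSmooth_slice ht).isContDiff (by simp)
  have hρpos : ∀ t ∈ Ico 0 T, ∀ x, 0 < V t x 0 := fun t ht x => (hVO t ht x).1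
  have hθpos : ∀ t ∈ Ico 0 T, ∀ x, 0 < V t x 4 := fun t ht x => (hVO t ht x).2.2
  have hh'pos : ∀ t ∈ Ico 0 T, ∀ x, 0 < deriv (fun s : ℝ => s * ζ s) (V t x 0) := fun t ht x =>
    hhyp _ ⟨(hVO t ht x).1, (hVO t ht x).2.1⟩
  -- the dictionary between the components of the derivatives of `V` and those of `ρ, u, ϑ`
  have e_t0 : ∀ t ∈ Ico 0 T, ∀ x, (Torus.timeDerivWithin (Ico 0 T) V t x) 0 =
      Torus.timeDerivWithin (Ico 0 T) (fun s y => V s y 0) t x := fun t ht x =>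
    (timeDerivWithin_clm_apply (EuclideanSpace.proj (0 : Fin 5)) hV hS ht x).symm
  have e_t4 : ∀ t ∈ Ico 0 T, ∀ x, (Torus.timeDerivWithin (Ico 0 T) V t x) 4 =
      Torus.timeDerivWithin (Ico 0 T) (fun s y => V s y 4) t x := fun t ht x =>
    (timeDerivWithin_clm_apply (EuclideanSpace.proj (4 : Fin 5)) hV hS ht x).symm
  have e_tu : ∀ t ∈ Ico 0 T, ∀ x, ∀ j, (Torus.timeDerivWithin (Ico 0 T) V t x) (hsVelIdx j) =
      Torus.timeDerivWithin (Ico 0 T) (fun s y => hsVelPart (V s y)) t x j := fun t ht x j => by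
    rw [timeDerivWithin_clm_apply hsVelPart hV hS ht x, hsVelPart_apply]
  have e_x0 : ∀ t ∈ Ico 0 T, ∀ x, ∀ k, (Torus.partialDeriv k (V t) x) 0 =
      Torus.partialDeriv k (fun y => V t y 0) x := fun t ht x k =>
    (partialDeriv_clm_apply_of_isContDiff (EuclideanSpace.proj (0 : Fin 5)) (hV1 ht) k x).symm
  have e_x4 : ∀ t ∈ Ico 0 T, ∀ x, ∀ k, (Torus.partialDeriv k (V t) x) 4 =
      Torus.partialDeriv k (fun y => V t y 4) x := fun t ht x k =>
    (partialDeriv_clm_apply_of_isContDiff (EuclideanSpace.proj (4 : Fin 5)) (hV1 ht) k x).symm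
  have e_xu : ∀ t ∈ Ico 0 T, ∀ x, ∀ k j, (Torus.partialDeriv k (V t) x) (hsVelIdx j) =
      Torus.partialDeriv k (fun y => hsVelPart (V t y)) x j := fun t ht x k j => by
    rw [partialDeriv_clm_apply_of_isContDiff hsVelPart (hV1 ht) k x, hsVelPart_apply]
  have e_div : ∀ t ∈ Ico 0 T, ∀ x, ∑ k, (Torus.partialDeriv k (V t) x) (hsVelIdx k) =
      Torus.divergence (fun y => hsVelPart (V t y)) x := fun t ht x => by
    unfold Torus.divergence
    refine Finset.sum_congr rfl fun k _ => ?_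
    rw [e_xu t ht x k k, partialDeriv_apply_coord (hu1 ht) k x k]
  have hprim : IsPrimitiveEulerSolutionOn (EulerEOS.monatomicExcess ζ f) (Ico 0 T)
      (fun t x => V t x 0) (fun t x => hsVelPart (V t x)) (fun t x => V t x 4) := by
    refine IsPrimitiveEulerSolutionOn.of_symmetric_monatomicExcess hζ hS hρ hu hθ hρpos hθpos
      ?_ ?_ ?_
    · -- continuity, from row `0`
      intro t ht x
      have h := congr_fun (hEq t ht x) 0
      simp only [hA_def, hA₀_def] at h
      rw [symForm_row_zero] at h
      simp only [Pi.zero_apply] at h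
      rw [e_t0 t ht x, e_div t ht x] at h
      simp only [e_x0 t ht x] at h
      have hr : V t x 0 ≠ 0 := (hρpos t ht x).ne'
      have hane : V t x 4 * deriv (fun s : ℝ => s * ζ s) (V t x 0) / V t x 0 ≠ 0 :=
        div_ne_zero (mul_ne_zero (hθpos t ht x).ne' (hh'pos t ht x).ne') hr
      have e : V t x 4 * deriv (fun s : ℝ => s * ζ s) (V t x 0) / V t x 0 *
          (Torus.timeDerivWithin (Ico 0 T) (fun s y => V s y 0) t x +
            ∑ i, hsVelPart (V t x) i * Torus.partialDeriv i (fun y => V t y 0) x +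
            V t x 0 * Torus.divergence (fun y => hsVelPart (V t y)) x) =
          V t x 4 * deriv (fun s : ℝ => s * ζ s) (V t x 0) / V t x 0 *
            (Torus.timeDerivWithin (Ico 0 T) (fun s y => V s y 0) t x +
              ∑ k, V t x (hsVelIdx k) * Torus.partialDeriv k (fun y => V t y 0) x) +
          V t x 4 * deriv (fun s : ℝ => s * ζ s) (V t x 0) *
            Torus.divergence (fun y => hsVelPart (V t y)) x := by
        simp only [hsVelPart_apply]
        field_simp
      exact (mul_eq_zero.1 (e.trans h)).resolve_left hane
    · -- Euler, from rows `1, 2, 3`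
      intro t ht x
      have hr : V t x 0 ≠ 0 := (hρpos t ht x).ne'
      have hcomp : ∀ j : Fin 3,
          Torus.timeDerivWithin (Ico 0 T) (fun s y => hsVelPart (V s y)) t x j +
            ∑ i, V t x (hsVelIdx i) * Torus.partialDeriv i (fun y => hsVelPart (V t y)) x j +
            V t x 4 * deriv (fun s : ℝ => s * ζ s) (V t x 0) / V t x 0 *
              Torus.partialDeriv j (fun y => V t y 0) x +
            ζ (V t x 0) * Torus.partialDeriv j (fun y => V t y 4) x = 0 := by
        intro j
        have h := congr_fun (hEq t ht x) (hsVelIdx j)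
        simp only [hA_def, hA₀_def] at h
        rw [symForm_row_vel] at h
        simp only [Pi.zero_apply] at h
        rw [e_tu t ht x, e_x0 t ht x, e_x4 t ht x] at h
        simp only [e_xu t ht x] at h
        have e : V t x 0 * (Torus.timeDerivWithin (Ico 0 T) (fun s y => hsVelPart (V s y)) t x j +
            ∑ i, V t x (hsVelIdx i) * Torus.partialDeriv i (fun y => hsVelPart (V t y)) x j +
            V t x 4 * deriv (fun s : ℝ => s * ζ s) (V t x 0) / V t x 0 *
              Torus.partialDeriv j (fun y => V t y 0) x +
            ζ (V t x 0) * Torus.partialDeriv j (fun y => V t y 4) x) =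
            V t x 0 * (Torus.timeDerivWithin (Ico 0 T) (fun s y => hsVelPart (V s y)) t x j +
              ∑ k, V t x (hsVelIdx k) * Torus.partialDeriv k (fun y => hsVelPart (V t y)) x j) +
            V t x 4 * deriv (fun s : ℝ => s * ζ s) (V t x 0) * Torus.partialDeriv j (fun y => V t y 0) x +
            V t x 0 * ζ (V t x 0) * Torus.partialDeriv j (fun y => V t y 4) x := by
          field_simp
        exact (mul_eq_zero.1 (e.trans h)).resolve_left hr
      have hg0 : ∀ j, Torus.gradient (fun y => V t y 0) x j = Torus.partialDeriv j (fun y => V t y 0) x :=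
        fun j => torusGradient_apply (hρ1 ht) x j
      have hg4 : ∀ j, Torus.gradient (fun y => V t y 4) x j = Torus.partialDeriv j (fun y => V t y 4) x :=
        fun j => torusGradient_apply (hθ1 ht) x j
      ext j
      have h3 := hcomp j
      simp [hg0, hg4]
      linear_combination h3
    · -- temperature, from row `4`
      intro t ht x
      have h := congr_fun (hEq t ht x) 4
      simp only [hA_def, hA₀_def] at h
      rw [symForm_row_four] at h
      simp only [Pi.zero_apply] at h
      rw [e_t4 t ht x, e_div t ht x] at h
      simp only [e_x4 t ht x] at h
      have hr : V t x 0 ≠ 0 := (hρpos t ht x).ne'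
      have hθne : V t x 4 ≠ 0 := (hθpos t ht x).ne'
      have hcne : 3 * V t x 0 / (2 * V t x 4) ≠ 0 :=
        div_ne_zero (mul_ne_zero three_ne_zero hr) (mul_ne_zero two_ne_zero hθne)
      have e : 3 * V t x 0 / (2 * V t x 4) *
          (Torus.timeDerivWithin (Ico 0 T) (fun s y => V s y 4) t x +
            ∑ i, hsVelPart (V t x) i * Torus.partialDeriv i (fun y => V t y 4) x +
            2 / 3 * (V t x 4 * ζ (V t x 0)) * Torus.divergence (fun y => hsVelPart (V t y)) x) =
          3 * V t x 0 / (2 * V t x 4) *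
            (Torus.timeDerivWithin (Ico 0 T) (fun s y => V s y 4) t x +
              ∑ k, V t x (hsVelIdx k) * Torus.partialDeriv k (fun y => V t y 4) x) +
          V t x 0 * ζ (V t x 0) * Torus.divergence (fun y => hsVelPart (V t y)) x := by
        simp only [hsVelPart_apply]
        field_simp
      exact (mul_eq_zero.1 (e.trans h)).resolve_left hcne
  exact isClassicalEulerSolution_monatomicExcess_of_primitive hζ hprim

end CompressibleEuler

open CompressibleEuler in
/-- **`CompressibleEulerLocalWellPosedness` holds** (Majda 1984, Ch. 2, Thms 2.1–2.2 with
Cor. 1–2, for the complete Euler system of a monatomic fluid with an athermal pressure law on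
`𝕋³`, `C^∞` rendering): clause (i) is `CompressibleEuler.localExistence_monatomicExcess`
(symmetric form + the tree's local existence theorem for quasilinear symmetric hyperbolic
systems on `𝕋³`), clause (ii) follows from clause (i) by
`compressibleEulerLocalWellPosedness_of_localExistence` (a-priori `H^m` bounds, extension and
junction). [cite: Majda1984, Ch. 2 §2.1 Thms 2.1–2.2, Cor. 1–2] -/
theorem CompressibleEulerLocalWellPosedness_holds : CompressibleEulerLocalWellPosedness :=
  compressibleEulerLocalWellPosedness_of_localExistence
    fun _ζ _f _ρm hζ hρm hζ' _ρ₀ _θ₀ _u₀ hρ₀ hθ₀ hu₀ hρ₀pos hρ₀lt hθ₀pos =>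
      localExistence_monatomicExcess hζ hρm hζ' hρ₀ hθ₀ hu₀ hρ₀pos hρ₀lt hθ₀pos

end Literature.Analysis.FluidPDE

end
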